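import Summits.Langlands.Langlands.Theorems.IrreducibilityBySelfDualityIrreducibleOffSectorIsobaricRigidityPrelim
import HarnessLib

/-!
# Isobaric rigidity at unramified places — RANK-LOCAL form of the Jacquet–Shalika input (2.3)
(crux `IrreducibilityBySelfDuality.IrreducibleOffSector`, stmt-Langlands-14329, line `Sketch`; `--supports`)

`isobaricRigidity_of_JS` (p102635) takes Arthur–Clozel (2.3) as the all-ranks named fact
`JacquetShalika1981_partialPairL_pole_repData`, yet its proof (see `…IsobaricRigidityPrelim`) uses
(2.3) only for pairs of EQUAL rank `m_i = m_{i₀}` over the one field `K`.  This file re-runs that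
proof verbatim with the weaker hypothesis.  As (2.3) is a THEOREM of the tree in ranks one and two
(`JacquetShalika1981_partialPairL_pole_repData_one`, `…_rank_of_le_two`), rigidity of a cuspidal `π`
against sums of Hecke characters then needs (2.2) alone.  Refs: Jacquet–Shalika, Amer. J. Math. 103
(1981) II, Thm. 4.4; Arthur–Clozel, Ann. of Math. Stud. 120, Ch. 3 §2, proof of Thm. 4.2 (d).
-/



noncomputable section

set_option linter.dupNamespace false

open scoped Topology Classical NumberField
open NumberField IsDedekindDomain Filter Polynomial
open Literature.NumberTheory.Automorphic
open Literature.NumberTheory.GaloisRepresentations (HeckeCharacter ideleGroup)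

namespace Summit.Langlands.Langlands.Theorems.IrreducibleOffSector

/-- **The analytic package of a pair** `(τ, τ')` of cuspidal Borel–Jacquet data on `GL_r × GL_{r'}`,
with (2.3) granted only for pairs of cuspidal data on `GL_{r'}(𝔸_K)`: (2.1) multipliability [theorem],
continuity and non-vanishing on `Re s > 1` [theorem], (2.2) off `X` at `s₀ = 1` [all-ranks hypothesis],
(2.3) on `X` [rank `r'` over `K`]. Same proof as `exists_analyticPackage` (p101770).
[cite: ArthurClozelAMS120, Ch. 3 §2 (2.1)–(2.3)] -/
theorem exists_analyticPackage_of_rank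
    (h22 : JacquetShalika1981_partialPairL_boundary_repData)
    {K : Type} [Field K] [NumberField K]
    {r r' : ℕ} [NeZero r] [NeZero r'] {hr : isCompact_glFiniteIntegralLevel r K}
    {hr' : isCompact_glFiniteIntegralLevel r' K}
    (h23 : ∀ (τ₂ τ₂' : CuspidalAutomorphicRepData r' K hr'),
      ∃ S₀ : Set (HeightOneSpectrum (𝓞 K)), S₀.Finite ∧
        ∀ {S : Set (HeightOneSpectrum (𝓞 K))} (_hS : S.Finite) (_hS₀ : S₀ ⊆ S)
          {α β : SatakeFamily K} (_hα : ∀ w ∉ S, τ₂.1.HasSatakeParamAt w (α w))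
          (_hβ : ∀ w ∉ S, τ₂'.1.HasSatakeParamAt w (β w))
          (_hu : ∀ w ∉ S, ‖(α w).prod‖ = 1) (_hu' : ∀ w ∉ S, ‖(β w).prod‖ = 1)
          {s₀ : ℂ} (_hs₀ : s₀.re = 1)
          (_hX : ∀ᶠ w in cofinite,
            (α w).map (((w.residueCard : ℂ) ^ (1 - s₀)) * ·) = (β w).map (·⁻¹)),
          ∃ c : ℂ, c ≠ 0 ∧
            Tendsto (fun s => (s - s₀) * partialPairL S α β s) (𝓝[{s : ℂ | 1 < s.re}] s₀) (𝓝 c))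
    (τ : CuspidalAutomorphicRepData r K hr) (τ' : CuspidalAutomorphicRepData r' K hr') :
    ∃ S₀ : Set (HeightOneSpectrum (𝓞 K)), S₀.Finite ∧
      ∀ {S : Set (HeightOneSpectrum (𝓞 K))} (_hS : S.Finite) (_hS₀ : S₀ ⊆ S)
        {γ γ' : SatakeFamily K} (_hγ : ∀ w ∉ S, τ.1.HasSatakeParamAt w (γ w))
        (_hγ' : ∀ w ∉ S, τ'.1.HasSatakeParamAt w (γ' w))
        (_hu : ∀ w ∉ S, ‖(γ w).prod‖ = 1) (_hu' : ∀ w ∉ S, ‖(γ' w).prod‖ = 1),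
        (∀ s : ℂ, 1 < s.re → Multipliable fun v : {v : HeightOneSpectrum (𝓞 K) // v ∉ S} =>
          ((satakePairPolynomial (γ v.1) (γ' v.1)).eval ((v.1.residueCard : ℂ) ^ (-s)))⁻¹) ∧
        (∀ s : ℂ, 1 < s.re → ContinuousAt (partialPairL S γ γ') s ∧ partialPairL S γ γ' s ≠ 0) ∧
        (¬ (r = r' ∧ ∀ᶠ w in cofinite, (γ w).map (((w.residueCard : ℂ) ^ (1 - (1 : ℂ))) * ·) =
            (γ' w).map (·⁻¹)) →
          ∃ c : ℂ, c ≠ 0 ∧ Tendsto (partialPairL S γ γ') (𝓝[{s : ℂ | 1 < s.re}] 1) (𝓝 c)) ∧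
        ((r = r' ∧ ∀ᶠ w in cofinite, (γ w).map (((w.residueCard : ℂ) ^ (1 - (1 : ℂ))) * ·) =
            (γ' w).map (·⁻¹)) →
          ∃ c : ℂ, c ≠ 0 ∧ Tendsto (fun s => (s - 1) * partialPairL S γ γ' s)
            (𝓝[{s : ℂ | 1 < s.re}] 1) (𝓝 c)) := by
  have hrpos : 0 < r := Nat.pos_of_ne_zero (NeZero.ne r)
  have hr'pos : 0 < r' := Nat.pos_of_ne_zero (NeZero.ne r')
  obtain ⟨S₁, hS₁, h1⟩ :=
    JacquetShalika1981_multipliable_partialPairL_repData_holds r r' K hr hr' hrpos hr'pos τ τ'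
  obtain ⟨S₂, hS₂, h2⟩ := continuousAt_and_ne_zero_partialPairL_repData τ τ'
  obtain ⟨S₃, hS₃, h3⟩ := h22 r r' K hr hr' hrpos hr'pos τ τ'
  have hone : (1 : ℂ).re = 1 := Complex.one_re
  by_cases e : r = r'
  · -- same rank: the pole clause is available after transport
    obtain ⟨τ₁, hτ₁⟩ := exists_transport_rank e hr hr' τ
    obtain ⟨S₄, hS₄, h4⟩ := h23 τ₁ τ'
    refine ⟨S₁ ∪ S₂ ∪ S₃ ∪ S₄, ((hS₁.union hS₂).union hS₃).union hS₄, ?_⟩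
    intro S hS hS₀ γ γ' hγ hγ' hu hu'
    have hS₁S : S₁ ⊆ S := fun x hx => hS₀ (Or.inl (Or.inl (Or.inl hx)))
    have hS₂S : S₂ ⊆ S := fun x hx => hS₀ (Or.inl (Or.inl (Or.inr hx)))
    have hS₃S : S₃ ⊆ S := fun x hx => hS₀ (Or.inl (Or.inr hx))
    have hS₄S : S₄ ⊆ S := fun x hx => hS₀ (Or.inr hx)
    refine ⟨fun s hs => h1 hS hS₁S hγ hγ' hu hu' hs, fun s hs => h2 hS hS₂S hγ hγ' hu hu' hs,
      fun hX => h3 hS hS₃S hγ hγ' hu hu' hone hX, fun hX => ?_⟩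
    have hγ₁ : ∀ w ∉ S, τ₁.1.HasSatakeParamAt w (γ w) := fun w hw => (hτ₁ w (γ w)).1 (hγ w hw)
    exact h4 hS hS₄S hγ₁ hγ' hu hu' hone hX.2
  · refine ⟨S₁ ∪ S₂ ∪ S₃, (hS₁.union hS₂).union hS₃, ?_⟩
    intro S hS hS₀ γ γ' hγ hγ' hu hu'
    have hS₁S : S₁ ⊆ S := fun x hx => hS₀ (Or.inl (Or.inl hx))
    have hS₂S : S₂ ⊆ S := fun x hx => hS₀ (Or.inl (Or.inr hx))
    have hS₃S : S₃ ⊆ S := fun x hx => hS₀ (Or.inr hx)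
    exact ⟨fun s hs => h1 hS hS₁S hγ hγ' hu hu' hs, fun s hs => h2 hS hS₂S hγ hγ' hu hu' hs,
      fun hX => h3 hS hS₃S hγ hγ' hu hu' hone hX, fun hX => absurd hX.1 e⟩

/-- **Isobaric rigidity at unramified places, with (2.3) only in the ranks of the blocks**
(Jacquet–Shalika 1981 II, Thm. 4.4; Arthur–Clozel Ch. 3 (2.4)): granted (2.2) for Borel–Jacquet data
and (2.3) for pairs of cuspidal data on `GL_{m_i}(𝔸_K)` for each block rank `m_i`, a cuspidal `π` on
`GL_n(𝔸_K)` (`n ≥ 1`) is not a.e. the Satake-union of `k ≥ 2` cuspidal `σ_i` on `GL_{m_i}(𝔸_K)`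
(`m_i ≥ 1`). Same proof as `isobaricRigidity_of_JS` (p102635): both analytic packages have second datum
`σ̃_{i₀}⁰` of rank `m_{i₀}`. [cite: JacquetShalikaAJM1981II, Thm. 4.4] [cite: ArthurClozelAMS120, Ch. 3 §2 (2.4)] -/
theorem isobaricRigidity_of_JS_of_rank
    (h22 : JacquetShalika1981_partialPairL_boundary_repData)
    (K : Type) [Field K] [NumberField K] (n : ℕ) (hcpt : isCompact_glFiniteIntegralLevel n K)
    (hn : 0 < n) (π : CuspidalAutomorphicRepData n K hcpt) (k : ℕ) (m : Fin k → ℕ)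
    (hm : ∀ i, isCompact_glFiniteIntegralLevel (m i) K)
    (h23 : ∀ (i : Fin k) (τ₂ τ₂' : CuspidalAutomorphicRepData (m i) K (hm i)),
      ∃ S₀ : Set (HeightOneSpectrum (𝓞 K)), S₀.Finite ∧
        ∀ {S : Set (HeightOneSpectrum (𝓞 K))} (_hS : S.Finite) (_hS₀ : S₀ ⊆ S)
          {α β : SatakeFamily K} (_hα : ∀ w ∉ S, τ₂.1.HasSatakeParamAt w (α w))
          (_hβ : ∀ w ∉ S, τ₂'.1.HasSatakeParamAt w (β w))
          (_hu : ∀ w ∉ S, ‖(α w).prod‖ = 1) (_hu' : ∀ w ∉ S, ‖(β w).prod‖ = 1)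
          {s₀ : ℂ} (_hs₀ : s₀.re = 1)
          (_hX : ∀ᶠ w in cofinite,
            (α w).map (((w.residueCard : ℂ) ^ (1 - s₀)) * ·) = (β w).map (·⁻¹)),
          ∃ c : ℂ, c ≠ 0 ∧
            Tendsto (fun s => (s - s₀) * partialPairL S α β s) (𝓝[{s : ℂ | 1 < s.re}] s₀) (𝓝 c))
    (σ : ∀ i, CuspidalAutomorphicRepData (m i) K (hm i)) (hk : 2 ≤ k) (hmpos : ∀ i, 0 < m i) :
    ¬ ∀ᶠ v : HeightOneSpectrum (𝓞 K) in cofinite, ∀ α : Multiset ℂ, π.1.HasSatakeParamAt v α →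
      ∃ β : Fin k → Multiset ℂ, (∀ i, (σ i).1.HasSatakeParamAt v (β i)) ∧ α = ∑ i, β i := by
  intro H
  haveI : NeZero n := ⟨hn.ne'⟩
  haveI hmi : ∀ i, NeZero (m i) := fun i => ⟨(hmpos i).ne'⟩
  -- Step 1: unitary twists of all the data
  obtain ⟨a, π₀, A, Tπ, hTπ, hA, hAu, hAcard, hAshift⟩ := exists_unitary_twist hcpt π
  have hσtw := fun i => exists_unitary_twist (hm i) (σ i)
  choose b σ₀ B T hT hB hBu hBcard hBshift using hσtw
  -- the real exponents and a maximal one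
  set d : Fin k → ℝ := fun i => b i - a with hd
  have hk0 : 0 < k := by omega
  obtain ⟨i₀, -, hi₀⟩ := Finset.exists_max_image (Finset.univ : Finset (Fin k)) d ⟨⟨0, hk0⟩, by simp⟩
  set dm : ℝ := d i₀ with hdm
  have hdle : ∀ i, d i ≤ dm := fun i => hi₀ i (Finset.mem_univ i)
  -- Step 2: the contragredient of `σ₀ i₀`
  obtain ⟨σc, hσc⟩ := CuspidalAutomorphicRepData.exists_contragredient_satake_holds (hm i₀) (σ₀ i₀)
  set Bc : SatakeFamily K := fun w => (B i₀ w).map (·⁻¹) with hBc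
  -- Step 3: analytic packages and the exceptional sets
  obtain ⟨S₀₀, hS₀₀, P₀⟩ := exists_analyticPackage_of_rank h22 (h23 i₀) π₀ σc
  have hPi := fun i => exists_analyticPackage_of_rank h22 (h23 i₀) (σ₀ i) σc
  choose Sx hSx P using hPi
  rw [Filter.eventually_cofinite] at H
  set Ebad : Set (HeightOneSpectrum (𝓞 K)) := {v | ¬ ∀ α : Multiset ℂ, π.1.HasSatakeParamAt v α →
    ∃ β : Fin k → Multiset ℂ, (∀ i, (σ i).1.HasSatakeParamAt v (β i)) ∧ α = ∑ i, β i} with hEbad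
  have hur := AutomorphicRepData.hasSatakeParamAt_cofinite_holds π.1
  rw [AutomorphicRepData.hasSatakeParamAt_cofinite, Filter.eventually_cofinite] at hur
  set Uram : Set (HeightOneSpectrum (𝓞 K)) := {v | ¬ π.1.IsUnramifiedAt v} with hUram
  set S : Set (HeightOneSpectrum (𝓞 K)) := Tπ ∪ (⋃ i, T i) ∪ Ebad ∪ Uram ∪ S₀₀ ∪ (⋃ i, Sx i) with hSdef
  have hS : S.Finite :=
    ((((hTπ.union (Set.finite_iUnion hT)).union H).union hur).union hS₀₀).union
      (Set.finite_iUnion hSx)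
  have hTπS : Tπ ⊆ S := fun x hx => Or.inl (Or.inl (Or.inl (Or.inl (Or.inl hx))))
  have hTS : ∀ i, T i ⊆ S := fun i x hx =>
    Or.inl (Or.inl (Or.inl (Or.inl (Or.inr (Set.mem_iUnion.2 ⟨i, hx⟩)))))
  have hEbadS : Ebad ⊆ S := fun x hx => Or.inl (Or.inl (Or.inl (Or.inr hx)))
  have hUramS : Uram ⊆ S := fun x hx => Or.inl (Or.inl (Or.inr hx))
  have hS₀₀S : S₀₀ ⊆ S := fun x hx => Or.inl (Or.inr hx)
  have hSxS : ∀ i, Sx i ⊆ S := fun i x hx => Or.inr (Set.mem_iUnion.2 ⟨i, hx⟩)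
  -- Satake families off `S`
  have hAS : ∀ w ∉ S, π₀.1.HasSatakeParamAt w (A w) := fun w hw => hA w fun h => hw (hTπS h)
  have hAuS : ∀ w ∉ S, ‖(A w).prod‖ = 1 := fun w hw => hAu w fun h => hw (hTπS h)
  have hBS : ∀ i, ∀ w ∉ S, (σ₀ i).1.HasSatakeParamAt w (B i w) := fun i w hw => hB i w (hw <| hTS i ·)
  have hBuS : ∀ i, ∀ w ∉ S, ‖(B i w).prod‖ = 1 := fun i w hw => hBu i w fun h => hw (hTS i h)
  have hBcS : ∀ w ∉ S, σc.1.HasSatakeParamAt w (Bc w) := fun w hw => hσc w _ (hBS i₀ w hw)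
  have hBcuS : ∀ w ∉ S, ‖(Bc w).prod‖ = 1 := fun w hw => by
    have h := Multiset.prod_map_inv' (B i₀ w)
    simp only [hBc]
    rw [show (fun x : ℂ => x⁻¹) = Inv.inv from rfl, h, norm_inv, hBuS i₀ w hw, inv_one]
  -- Step 4: the relation between the unitary families off `S`
  have hR : ∀ w ∉ S, A w = ∑ i, (B i w).map (((w.residueCard : ℂ) ^ ((d i : ℝ) : ℂ)) * ·) := by
    intro w hw
    have hwU : w ∉ Uram := fun h => hw (hUramS h)
    have hwE : w ∉ Ebad := fun h => hw (hEbadS h)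
    simp only [hUram, Set.mem_setOf_eq, not_not] at hwU
    simp only [hEbad, Set.mem_setOf_eq, not_not] at hwE
    obtain ⟨α, hα⟩ := hwU
    obtain ⟨β, hβ, hαβ⟩ := hwE α hα
    have h1 : α = (A w).map (((w.residueCard : ℂ) ^ ((a : ℝ) : ℂ)) * ·) :=
      hAshift w (fun h => hw (hTπS h)) α hα
    have h2 : ∀ i, β i = (B i w).map (((w.residueCard : ℂ) ^ ((b i : ℝ) : ℂ)) * ·) := fun i =>
      hBshift i w (fun h => hw (hTS i h)) (β i) (hβ i)
    have hq := natCast_residueCard_ne_zero w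
    have hqa : (w.residueCard : ℂ) ^ ((a : ℝ) : ℂ) ≠ 0 := residueCard_cpow_ne_zero w _
    have h3 : A w = α.map ((((w.residueCard : ℂ) ^ ((a : ℝ) : ℂ))⁻¹) * ·) := by
      rw [h1, map_const_mul_map_const_mul, inv_mul_cancel₀ hqa]
      simp
    rw [h3, hαβ, map_finset_sum_multiset]
    refine Finset.sum_congr rfl fun i _ => ?_
    rw [h2 i, map_const_mul_map_const_mul]
    refine Multiset.map_congr rfl fun x _ => ?_
    congr 1
    rw [← Complex.cpow_neg, ← Complex.cpow_add _ _ hq]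
    congr 1
    simp only [hd]
    push_cast
    ring
  -- Step 5: ranks and exponents
  obtain ⟨w₁, hw₁⟩ := exists_not_mem_of_finite hS
  have hnsum : n = ∑ i, m i := by
    have h := congrArg Multiset.card (hR w₁ hw₁)
    rw [hAcard w₁ (fun h => hw₁ (hTπS h)), card_finset_sum_multiset] at h
    rw [h]
    refine Finset.sum_congr rfl fun i _ => ?_
    rw [Multiset.card_map, hBcard i w₁ (fun h => hw₁ (hTS i h))]
  have hlt : m i₀ < n := by
    obtain ⟨j, hj⟩ : ∃ j : Fin k, j ≠ i₀ := by
      by_cases h0 : i₀ = ⟨0, hk0⟩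
      · exact ⟨⟨1, by omega⟩, fun h => by rw [h0] at h; exact absurd (congrArg Fin.val h) (by simp)⟩
      · exact ⟨⟨0, hk0⟩, fun h => h0 h.symm⟩
    rw [hnsum, ← Finset.add_sum_erase _ _ (Finset.mem_univ i₀)]
    have hjmem : j ∈ Finset.univ.erase i₀ := Finset.mem_erase.2 ⟨hj, Finset.mem_univ j⟩
    have hle : m j ≤ ∑ x ∈ Finset.univ.erase i₀, m x :=
      Finset.single_le_sum (fun x _ => Nat.zero_le (m x)) hjmem
    have := hmpos j
    omega
  have hsum0 : ∑ i, (m i : ℝ) * d i = 0 := by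
    have h := congrArg (fun α : Multiset ℂ => ‖α.prod‖) (hR w₁ hw₁)
    rw [hAuS w₁ hw₁, prod_finset_sum_multiset, norm_prod] at h
    have h' : ∀ i, ‖((B i w₁).map (((w₁.residueCard : ℂ) ^ ((d i : ℝ) : ℂ)) * ·)).prod‖ =
        (w₁.residueCard : ℝ) ^ ((m i : ℝ) * d i) := by
      intro i
      rw [prod_map_const_mul_eq, norm_mul, norm_pow, hBuS i w₁ hw₁, mul_one,
        hBcard i w₁ (fun h => hw₁ (hTS i h)), norm_residueCard_cpow, Complex.ofReal_re,
        ← Real.rpow_natCast, ← Real.rpow_mul (Nat.cast_nonneg _), mul_comm]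
    simp only [h'] at h
    rw [← Real.rpow_sum_of_pos (by exact_mod_cast Nat.zero_lt_of_lt w₁.one_lt_residueCard)] at h
    exact rpow_eq_one_iff_of_one_lt w₁.one_lt_residueCard h.symm
  have hdm0 : 0 ≤ dm := by
    by_contra hneg
    push Not at hneg
    have hlt0 : ∑ i, (m i : ℝ) * d i < 0 := by
      have : 0 < ∑ i, -((m i : ℝ) * d i) := by
        refine Finset.sum_pos (fun i _ => ?_) ⟨i₀, Finset.mem_univ _⟩
        have hmi0 : (0 : ℝ) < m i := by exact_mod_cast hmpos i
        have hdi : d i < 0 := lt_of_le_of_lt (hdle i) hneg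
        nlinarith
      have e : ∑ i, -((m i : ℝ) * d i) = -∑ i, (m i : ℝ) * d i := Finset.sum_neg_distrib ..
      linarith
    exact absurd hsum0 (ne_of_lt hlt0)
  -- Step 6: the filter at `s₀ = 1 + dm` inside `Re s > 1 + dm`
  set s₀ : ℂ := ((1 + dm : ℝ) : ℂ) with hs₀
  set U : Set ℂ := {s : ℂ | 1 + dm < s.re} with hU
  haveI hl : (𝓝[U] s₀).NeBot := by
    have := neBot_nhdsWithin_lt_re (1 + dm)
    simpa only [hU, hs₀] using this
  have hsub0 : Tendsto (fun s : ℂ => s - s₀) (𝓝[U] s₀) (𝓝 0) := by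
    have h : Tendsto (fun s : ℂ => s - s₀) (𝓝 s₀) (𝓝 (s₀ - s₀)) :=
      (continuous_id.sub continuous_const).tendsto s₀
    rw [sub_self] at h
    exact h.mono_left nhdsWithin_le_nhds
  -- the shifted variable `s - d i` for a maximal exponent lands in `Re > 1` at `1`
  have hshiftX : ∀ i, d i = dm → Tendsto (fun s : ℂ => s - ((d i : ℝ) : ℂ)) (𝓝[U] s₀)
      (𝓝[{s : ℂ | 1 < s.re}] 1) := by
    intro i hi
    refine tendsto_nhdsWithin_of_tendsto_nhds_of_eventually_within _ ?_ ?_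
    · have h : Tendsto (fun s : ℂ => s - ((d i : ℝ) : ℂ)) (𝓝 s₀) (𝓝 (s₀ - ((d i : ℝ) : ℂ))) :=
        (continuous_id.sub continuous_const).tendsto s₀
      have e : s₀ - ((d i : ℝ) : ℂ) = 1 := by
        rw [hs₀, hi]; push_cast; ring
      rw [e] at h
      exact h.mono_left nhdsWithin_le_nhds
    · filter_upwards [self_mem_nhdsWithin] with s hs
      simp only [Set.mem_setOf_eq, Complex.sub_re, Complex.ofReal_re, hU] at hs ⊢
      linarith
  -- Step 7: the factors
  set F : Fin k → ℂ → ℂ := fun i => partialPairL S (B i) Bc with hF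
  set G : Fin k → ℂ → ℂ := fun i s => F i (s - ((d i : ℝ) : ℂ)) with hG
  set L : ℂ → ℂ := partialPairL S A Bc with hL
  -- the `X`-condition of the pair `(σ₀ i, σc)` at `s₀ = 1`
  set X : Fin k → Prop := fun i => m i = m i₀ ∧ ∀ᶠ w in cofinite,
    (B i w).map (((w.residueCard : ℂ) ^ (1 - (1 : ℂ))) * ·) = (Bc w).map (·⁻¹) with hX
  have hX₀ : X i₀ := by
    refine ⟨rfl, Filter.Eventually.of_forall fun w => ?_⟩
    simp only [hBc, sub_self, Complex.cpow_zero, one_mul, Multiset.map_id', Multiset.map_map,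
      Function.comp_def, inv_inv]
  set e : Fin k → ℕ := fun i => if d i = dm ∧ X i then 1 else 0 with he
  have he₀ : e i₀ = 1 := if_pos ⟨rfl, hX₀⟩
  -- Step 7a: each factor, weighted by `(s - s₀)^{e i}`, has a finite NON-ZERO limit along the filter
  have hGlim : ∀ i, ∃ c : ℂ, c ≠ 0 ∧
      Tendsto (fun s => (s - s₀) ^ (e i) * G i s) (𝓝[U] s₀) (𝓝 c) := by
    intro i
    obtain ⟨h21i, hconti, hbdyi, hpolei⟩ :=
      P i hS (hSxS i) (hBS i) hBcS (hBuS i) hBcuS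
    by_cases hdi : d i = dm
    · by_cases hXi : X i
      · -- pole: Arthur–Clozel (2.3)
        obtain ⟨c, hc, hten⟩ := hpolei hXi
        refine ⟨c, hc, ?_⟩
        have hcomp := hten.comp (hshiftX i hdi)
        have hei : e i = 1 := if_pos ⟨hdi, hXi⟩
        refine (hcomp.congr fun s => ?_)
        simp only [Function.comp_apply, hei, pow_one, hG]
        congr 1
        rw [hs₀, hdi]; push_cast; ring
      · -- finite non-zero boundary value: Arthur–Clozel (2.2)
        obtain ⟨c, hc, hten⟩ := hbdyi hXi
        refine ⟨c, hc, ?_⟩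
        have hcomp := hten.comp (hshiftX i hdi)
        have hei : e i = 0 := if_neg fun h => hXi h.2
        refine (hcomp.congr fun s => ?_)
        simp only [Function.comp_apply, hei, pow_zero, one_mul, hG, hF]
    · -- interior point: continuity and non-vanishing on `Re s > 1`
      have hdlt : d i < dm := lt_of_le_of_ne (hdle i) hdi
      set t : ℂ := s₀ - ((d i : ℝ) : ℂ) with ht
      have htre : 1 < t.re := by
        simp only [ht, hs₀, Complex.sub_re, Complex.ofReal_re]
        linarith
      obtain ⟨hcont, hne⟩ := hconti t htre
      refine ⟨F i t, hne, ?_⟩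
      have hei : e i = 0 := if_neg fun h => hdi h.1
      have h1 : Tendsto (fun s : ℂ => s - ((d i : ℝ) : ℂ)) (𝓝 s₀) (𝓝 t) :=
        (continuous_id.sub continuous_const).tendsto s₀
      have h2 : Tendsto (fun s => F i (s - ((d i : ℝ) : ℂ))) (𝓝 s₀) (𝓝 (F i t)) :=
        hcont.tendsto.comp h1
      refine ((h2.mono_left nhdsWithin_le_nhds).congr fun s => ?_)
      simp only [hei, pow_zero, one_mul, hG]
  choose c hc hclim using hGlim
  -- Step 7b: the left-hand side has a finite limit along the filter
  have hLlim : ∃ c₀ : ℂ, Tendsto L (𝓝[U] s₀) (𝓝 c₀) := by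
    obtain ⟨-, hcont0, hbdy0, -⟩ := P₀ hS hS₀₀S hAS hBcS hAuS hBcuS
    rcases eq_or_lt_of_le hdm0 with hdm00 | hdmpos
    · -- `dm = 0`: Arthur–Clozel (2.2) for `(π₀, σc)`, off `X` since `n ≠ m i₀`
      obtain ⟨c₀, -, hten⟩ := hbdy0 fun h => absurd h.1 (ne_of_gt hlt)
      refine ⟨c₀, ?_⟩
      have e1 : s₀ = 1 := by rw [hs₀, ← hdm00]; push_cast; ring
      have e2 : U = {s : ℂ | 1 < s.re} := by
        ext s; simp only [hU, Set.mem_setOf_eq, ← hdm00, add_zero]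
      rw [hL, e1, e2] at *
      exact hten
    · -- `dm > 0`: interior point
      have hre : 1 < s₀.re := by
        simp only [hs₀, Complex.ofReal_re]
        linarith
      obtain ⟨hcont, -⟩ := hcont0 s₀ hre
      exact ⟨L s₀, hcont.tendsto.mono_left nhdsWithin_le_nhds⟩
  obtain ⟨c₀, hc₀⟩ := hLlim
  -- Step 8: the product formula on `U`
  have hprodU : ∀ s ∈ U, L s = ∏ i, G i s := by
    intro s hs
    simp only [hU, Set.mem_setOf_eq] at hs
    -- Euler factors
    have hEuler : ∀ v : {v : HeightOneSpectrum (𝓞 K) // v ∉ S},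
        ((satakePairPolynomial (A v.1) (Bc v.1)).eval ((v.1.residueCard : ℂ) ^ (-s)))⁻¹ =
          ∏ i, ((satakePairPolynomial ((B i v.1).map (((v.1.residueCard : ℂ) ^ ((d i : ℝ) : ℂ)) * ·))
            (Bc v.1)).eval ((v.1.residueCard : ℂ) ^ (-s)))⁻¹ := by
      intro v
      rw [hR v.1 v.2, satakePairPolynomial_sum_left, Polynomial.eval_prod,
        Finset.prod_inv_distrib]
    -- shifts
    have hshα : ∀ i, ∀ w ∉ S, (fun w => (B i w).map (((w.residueCard : ℂ) ^ ((d i : ℝ) : ℂ)) * ·)) w =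
        (B i w).map (((w.residueCard : ℂ) ^ ((d i : ℝ) : ℂ)) * ·) := fun i w _ => rfl
    have hshβ : ∀ w ∉ S, Bc w = (Bc w).map (((w.residueCard : ℂ) ^ (0 : ℂ)) * ·) := fun w _ => by
      simp only [Complex.cpow_zero, one_mul, Multiset.map_id']
    have hmult : ∀ i, Multipliable fun v : {v : HeightOneSpectrum (𝓞 K) // v ∉ S} =>
        ((satakePairPolynomial ((B i v.1).map (((v.1.residueCard : ℂ) ^ ((d i : ℝ) : ℂ)) * ·))
          (Bc v.1)).eval ((v.1.residueCard : ℂ) ^ (-s)))⁻¹ := by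
      intro i
      obtain ⟨h21i, -, -, -⟩ := P i hS (hSxS i) (hBS i) hBcS (hBuS i) hBcuS
      have hfun := pairEulerFactor_eq_of_shift (S := S) (hshα i) hshβ s
      rw [hfun]
      refine h21i _ ?_
      simp only [Complex.sub_re, Complex.ofReal_re, add_zero]
      linarith [hdle i]
    calc L s = ∏' v : {v : HeightOneSpectrum (𝓞 K) // v ∉ S}, ∏ i,
          ((satakePairPolynomial ((B i v.1).map (((v.1.residueCard : ℂ) ^ ((d i : ℝ) : ℂ)) * ·))
            (Bc v.1)).eval ((v.1.residueCard : ℂ) ^ (-s)))⁻¹ := by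
          simp only [hL, partialPairL]
          exact tprod_congr hEuler
      _ = ∏ i, ∏' v : {v : HeightOneSpectrum (𝓞 K) // v ∉ S},
          ((satakePairPolynomial ((B i v.1).map (((v.1.residueCard : ℂ) ^ ((d i : ℝ) : ℂ)) * ·))
            (Bc v.1)).eval ((v.1.residueCard : ℂ) ^ (-s)))⁻¹ :=
          Multipliable.tprod_finsetProd fun i _ => hmult i
      _ = ∏ i, G i s := by
          refine Finset.prod_congr rfl fun i _ => ?_
          have hpl := partialPairL_eq_of_shift (S := S) (hshα i) hshβ
          have hval := congrFun hpl s
          simp only [add_zero] at hval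
          simp only [hG, hF]
          exact hval
  -- Step 9: the contradiction
  set N : ℕ := ∑ i, e i with hN
  have hN1 : 1 ≤ N := by
    rw [hN, ← Finset.add_sum_erase _ _ (Finset.mem_univ i₀), he₀]
    omega
  have hlim1 : Tendsto (fun s => (s - s₀) ^ N * L s) (𝓝[U] s₀) (𝓝 0) := by
    have h := (hsub0.pow N).mul hc₀
    rwa [zero_pow (by omega), zero_mul] at h
  have hlim2 : Tendsto (fun s => (s - s₀) ^ N * ∏ i, G i s) (𝓝[U] s₀) (𝓝 (∏ i, c i)) := by
    have h := tendsto_finsetProd (Finset.univ : Finset (Fin k)) fun i _ => hclim i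
    refine h.congr fun s => ?_
    rw [Finset.prod_mul_distrib, Finset.prod_pow_eq_pow_sum]
  have heq : (fun s => (s - s₀) ^ N * L s) =ᶠ[𝓝[U] s₀] fun s => (s - s₀) ^ N * ∏ i, G i s := by
    filter_upwards [self_mem_nhdsWithin] with s hs
    rw [hprodU s hs]
  have hprodne : ∏ i, c i ≠ 0 := Finset.prod_ne_zero_iff.2 fun i _ => hc i
  exact hprodne (tendsto_nhds_unique hlim2 (hlim1.congr' heq))

end Summit.Langlands.Langlands.Theorems.IrreducibleOffSector

end
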